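import Literature.Computability.AlgebraicComplexity.RectangularExponentCertTransfer
import Literature.Computability.AlgebraicComplexity.GlobalStageThreeRegions
import HarnessLib

/-!
# The assembly of the asymmetric laser method ("Algorithm 1" of VXXZ 2024 / ADVXXZ 2025): from the
outputs of the stages to a `CW_5` degeneration certificate — proved

Topic `Literature/Computability/AlgebraicComplexity`; companion of
`RectangularExponentLaserCertificate.lean` (the predicate `CW5DegenerationCertificate`, the named fact
`advxxz2025_laserDegeneration`) and `RectangularExponentSquareRecord.lean` (the record
`advxxz2025_omega_le : ω(ℂ) ≤ 2.371339` from the single row `CW5DegenerationCertificate [(1, 2.371339)]`).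

Alman–Duan–Vassilevska Williams–Xu–Xu–Zhou, *More asymmetry yields faster matrix multiplication*
(SODA 2025, arXiv:2404.16349), §7 "Numerical Result" (verbatim up to notation, as in VXXZ 2024 §8):
"Let `ℓ* > 0` … and let `N = 2^{ℓ*−1} · n`.  We repeatedly apply Theorem 5.3 (global stage),
Theorem 6.2 (matrix multiplication terms) and Theorem 6.4 (constituent stage) to degenerate a direct
sum of `2^{o(n)}` copies of `CW_q^{⊗N} ≡ (CW_q^{⊗2^{ℓ*−1}})^{⊗n}` into a direct sum of matrix
multiplication tensors `⟨a, a^κ, a⟩`" (Algorithm 1), the parameters being subject to the LIMITING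
CONDITION `lim_{ε→0} lim_{n→∞} V^{1/n} · min{A, B^{1/κ}, C}^{ω'/n} ≥ (q+2)^{2^{ℓ*−1}}` (the last
constraint of the displayed optimisation problem of §7), where (§4) the global stage outputs
independent copies of a level-`ℓ*` interface tensor, each constituent stage `ℓ = ℓ*, …, 2` turns
(`2^{o(n)}` copies of) a level-`ℓ` interface tensor into "a tensor product between independent copies
of level-`(ℓ−1)` interface tensors and a matrix multiplication tensor", and every level-1 interface
tensor "can then be degenerated into" a matrix multiplication tensor.

This file PROVES that assembly — everything between the three stage theorems and the certificate —
in two layers, with NO named facts and no definitions (D-0026):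

* **Stage chaining (tensor algebra, any commutative semiring).**  Writing `⟨F⟩ ⊗ T` for `F`
  independent copies and `≥` for restriction (`TensorRestrictsTo`; every step of the method is a
  zero-out/restriction, cf. `GlobalStageThreeRegions.vxxz2024_thm53`, `FixingHoles.vxxz2024_thm72`,
  `LevelOneInterface.vxxz2024_levelOne_degeneration`):
  `laserRecursion_start` (a global-stage output `⟨t⟩ ⊗ P ≥ ⟨V⟩ ⊗ S` is `⟨V⟩ ⊗ (S ⊗ ⟨1,1,1⟩)`),
  `laserRecursion_step` (**one level of the recursion**: from `⟨t⟩ ⊗ P ≥ ⟨V⟩ ⊗ (S ⊗ ⟨A,B,C⟩)` and a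
  constituent-stage output `⟨M⟩ ⊗ S ≥ ⟨V'⟩ ⊗ (S' ⊗ ⟨A',B',C'⟩)` to
  `⟨M t⟩ ⊗ P ≥ ⟨V V'⟩ ⊗ (S' ⊗ ⟨A A', B B', C C'⟩)` — the `2^{o(n)}` input copies of the stages
  multiply, the output copies multiply, the matrix multiplication tensors multiply),
  `laserRecursion_finish` (a level-1 degeneration `S ≥ ⟨A',B',C'⟩` closes the recursion:
  `⟨t⟩ ⊗ P ≥ ⟨V⟩ ⊗ ⟨A A', B B', C C'⟩`), with the relabelling lemmas they need
  (`tensorRestrictsTo_kronecker_comm`, `tensorRestrictsTo_kronecker_assoc'`,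
  `tensorRestrictsTo_kronecker_matMulTensor_one`; `⟨M t⟩ ≥ ⟨M⟩ ⊗ ⟨t⟩` is
  `GlobalStageThreeRegions.tensorRestrictsTo_mul_unitTensor`).
* **The limiting condition (analysis).**  `cw5Certificate_of_rates`: if for every `η > 0` and
  arbitrarily large `n` the method outputs `⟨t⟩ ⊗ (CW_5^{⊗L})^{⊗n} ⊵ ⟨V⟩ ⊗ ⟨A, B, C⟩` with
  `t ≤ 2^{ηn}`, `V ≥ 2^{(v−η)n}`, `A, C ≥ 2^{(m−η)n}`, `B ≥ 2^{(κm−η)n}` (the printed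
  `lim_{ε→0} lim_{n→∞}` of `V^{1/n}`, `A^{1/n}`, `B^{1/n}`, `C^{1/n}` in rate form, `m` a lower bound of
  `min{a, b/κ, c}`), and `L · log₂ 7 ≤ v + ω' · m` (the limiting condition with `q = 5`,
  `2^{ℓ*−1} = L`), then `CW5DegenerationCertificate [(κ, ω')]` — the `δ`-form consumed by
  `omegaRect_le_of_cw5DegenerationCertificate` (restrict `⟨A,B,C⟩` to `⟨a, B, a⟩` with
  `a = ⌊2^{(m − C_κ η) n}⌋`, `C_κ = max{2, 1/κ + 1}`, so that `a ≤ A`, `a ≤ C`, `a^κ ≤ B`, and absorb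
  all `η`-losses in `a^δ`).  `advxxz2025_omega_le_of_rates` is its specialisation
  `(κ, ω', L) = (1, 2.371339, 4)`: **the record `ω ≤ 2.371339` follows from the rate-form output of
  Algorithm 1 at the `κ = 1` parameter file**, i.e. from Thms. 5.3/6.2/6.4 at that point alone.
  Small conversions from the stage theorems' logarithmic bounds (`log₂(κ+1) ≥ n(E−δ)`,
  `log₂ t ≤ δ n`) to the rate form: `le_two_rpow_of_logb_le`, `two_rpow_sub_one_le_of_le_logb_succ`,
  `two_rpow_add_mul_le_mul`.

What this file does NOT contain is the content of the stage theorems themselves (ADVXXZ Thm. 5.3,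
Thm. 6.4 with their entropy exponents, at the 24 855-parameter point of `data/W1.00_2.371339.mat`):
that is the named fact `advxxz2025_laserDegeneration` minus the present assembly.

## References

* J. Alman, R. Duan, V. Vassilevska Williams, Y. Xu, Z. Xu, R. Zhou, *More asymmetry yields faster
  matrix multiplication*, SODA 2025, arXiv:2404.16349: §4 (algorithm outline: global stage,
  constituent stages `ℓ = ℓ*, …, 2`, level 1 → matrix multiplication; Thm. 4.2), Thm. 5.3, Thm. 6.2,
  Thm. 6.4, §7 (Algorithm 1 = `alg:framework`, the optimisation problem and its limiting condition,
  "we showed that `ω ≤ 2.371339`"). [AlmanDuanVassilevskaWilliamsXuXuZhou2025]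
* V. Vassilevska Williams, Y. Xu, Z. Xu, R. Zhou, *New bounds for matrix multiplication: from alpha
  to omega*, SODA 2024, arXiv:2307.07970: §4.1 (algorithm framework), §8 (Algorithm 1 and the
  optimisation problem). [VassilevskaWilliamsXuXuZhou2024]
* M. Bläser, *Fast Matrix Multiplication*, Theory of Computing Graduate Surveys 5 (2013), §5.2
  (`⟨k,m,n⟩ ⊗ ⟨k',m',n'⟩ ≅ ⟨kk',mm',nn'⟩`), Lemma 5.4 (relabellings are restrictions). [Blaser2013]
-/

noncomputable section

open scoped BigOperators

namespace Literature.Computability.AlgebraicComplexity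

open Literature.Barriers.MatrixMultiplication

universe u

/-! ## Relabelling lemmas -/

section Relabel

variable (K : Type u) [CommSemiring K]

/-- **Commutativity of the Kronecker product as a restriction**: `s ⊗ t ≥ t ⊗ s` (relabelling along
`Prod.swap`; indeed `≅`). [cite: Blaser2013, Lemma 5.4] -/
theorem tensorRestrictsTo_kronecker_comm {ι κ μ ι' κ' μ' : Type*} [Fintype ι] [Fintype κ]
    [Fintype μ] [Fintype ι'] [Fintype κ'] [Fintype μ'] [DecidableEq ι] [DecidableEq κ]
    [DecidableEq μ] [DecidableEq ι'] [DecidableEq κ'] [DecidableEq μ']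
    (s : ι → κ → μ → K) (t : ι' → κ' → μ' → K) :
    TensorRestrictsTo (kroneckerTensor s t) (kroneckerTensor t s) := by
  have key : kroneckerTensor t s = fun a b c =>
      kroneckerTensor s t (Equiv.prodComm _ _ a) (Equiv.prodComm _ _ b) (Equiv.prodComm _ _ c) := by
    funext a b c
    simp [mul_comm]
  rw [key]
  exact tensorRestrictsTo_precomp _ _ _ _

/-- **Associativity of the Kronecker product as a restriction, second direction**:
`(s ⊗ x) ⊗ y ≥ s ⊗ (x ⊗ y)` (relabelling along `Equiv.prodAssoc`; the first direction is
`tensorRestrictsTo_kronecker_assoc`). [cite: Blaser2013, Lemma 5.4] -/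
theorem tensorRestrictsTo_kronecker_assoc' {ι κ μ ι₁ κ₁ μ₁ ι₂ κ₂ μ₂ : Type*} [Fintype ι]
    [Fintype κ] [Fintype μ] [Fintype ι₁] [Fintype κ₁] [Fintype μ₁] [Fintype ι₂] [Fintype κ₂]
    [Fintype μ₂] [DecidableEq ι] [DecidableEq κ] [DecidableEq μ] [DecidableEq ι₁] [DecidableEq κ₁]
    [DecidableEq μ₁] [DecidableEq ι₂] [DecidableEq κ₂] [DecidableEq μ₂]
    (s : ι → κ → μ → K) (x : ι₁ → κ₁ → μ₁ → K) (y : ι₂ → κ₂ → μ₂ → K) :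
    TensorRestrictsTo (kroneckerTensor (kroneckerTensor s x) y)
      (kroneckerTensor s (kroneckerTensor x y)) := by
  have key : kroneckerTensor s (kroneckerTensor x y) = fun a b c =>
      kroneckerTensor (kroneckerTensor s x) y ((Equiv.prodAssoc _ _ _).symm a)
        ((Equiv.prodAssoc _ _ _).symm b) ((Equiv.prodAssoc _ _ _).symm c) := by
    funext a b c
    simp only [kroneckerTensor_apply, Equiv.prodAssoc_symm_apply]
    ring
  rw [key]
  exact tensorRestrictsTo_precomp _ _ _ _

/-- **`S ≥ S ⊗ ⟨1,1,1⟩`** (`⟨1,1,1⟩` is the scalar `1` on one-point formats; relabelling along the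
first projections). [folklore] -/
theorem tensorRestrictsTo_kronecker_matMulTensor_one {ι κ μ : Type*} [Fintype ι] [Fintype κ]
    [Fintype μ] [DecidableEq ι] [DecidableEq κ] [DecidableEq μ] (S : ι → κ → μ → K) :
    TensorRestrictsTo S (kroneckerTensor S (matMulTensor K 1 1 1)) := by
  have key : kroneckerTensor S (matMulTensor K 1 1 1) = fun a b c => S a.1 b.1 c.1 := by
    funext a b c
    have h1 : matMulTensor K 1 1 1 a.2 b.2 c.2 = 1 := by
      simp only [matMulTensor]
      rw [if_pos ⟨Subsingleton.elim _ _, Subsingleton.elim _ _, Subsingleton.elim _ _⟩]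
    rw [kroneckerTensor_apply, h1, mul_one]
  rw [key]
  exact tensorRestrictsTo_precomp S Prod.fst Prod.fst Prod.fst

/-- **`⟨t⟩ ⊗ T^{⊗(L n)} ≥ ⟨t⟩ ⊗ (T^{⊗L})^{⊗n}`**: the input of the certificate, `CW_q^{⊗N}` with
`N = 2^{ℓ*−1} n`, restricts to the input `(CW_q^{⊗2^{ℓ*−1}})^{⊗n}` of the global stage ("`CW_q^{⊗N} ≡
(CW_q^{⊗2^{ℓ*−1}})^{⊗n}`"). [cite: AlmanDuanVassilevskaWilliamsXuXuZhou2025, §7 (N = 2^{ℓ*−1}·n)] -/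
theorem tensorRestrictsTo_multiple_kroneckerPow_mul {ι κ μ : Type*} [Fintype ι] [Fintype κ]
    [Fintype μ] [DecidableEq ι] [DecidableEq κ] [DecidableEq μ] (T : ι → κ → μ → K) (t L n : ℕ) :
    TensorRestrictsTo (kroneckerTensor (unitTensor K t) (kroneckerPow T (L * n)))
      (kroneckerTensor (unitTensor K t) (kroneckerPow (kroneckerPow T L) n)) :=
  (TensorRestrictsTo.refl _).kronecker
    ((tensorRestrictsTo_kroneckerPow_of_eq T (Nat.mul_comm L n)).trans
      (tensorRestrictsTo_kroneckerPow_mul T n L))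

end Relabel

/-! ## Chaining the stages (Algorithm 1) -/

section Chaining

variable (K : Type u) [CommSemiring K]
variable {ιP κP μP ιS κS μS ιS' κS' μS' : Type*} [Fintype ιP] [Fintype κP] [Fintype μP]
  [Fintype ιS] [Fintype κS] [Fintype μS] [Fintype ιS'] [Fintype κS'] [Fintype μS']
  [DecidableEq ιP] [DecidableEq κP] [DecidableEq μP] [DecidableEq ιS] [DecidableEq κS]
  [DecidableEq μS] [DecidableEq ιS'] [DecidableEq κS'] [DecidableEq μS']

omit [DecidableEq ιP] [DecidableEq κP] [DecidableEq μP] in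
/-- **Start of the recursion**: a global-stage output `⟨t⟩ ⊗ P ≥ ⟨V⟩ ⊗ S` (`P` the input power,
`S` the level-`ℓ*` interface tensor) in the form `⟨t⟩ ⊗ P ≥ ⟨V⟩ ⊗ (S ⊗ ⟨1,1,1⟩)` carrying the
(so far trivial) matrix multiplication factor. [cite: AlmanDuanVassilevskaWilliamsXuXuZhou2025, §4 and §7 (Algorithm 1: the global stage, Thm. 5.3)] -/
theorem laserRecursion_start (P : ιP → κP → μP → K) (S : ιS → κS → μS → K) {t V : ℕ}
    (h : TensorRestrictsTo (kroneckerTensor (unitTensor K t) P) (kroneckerTensor (unitTensor K V) S)) :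
    TensorRestrictsTo (kroneckerTensor (unitTensor K t) P)
      (kroneckerTensor (unitTensor K V) (kroneckerTensor S (matMulTensor K 1 1 1))) :=
  h.trans ((TensorRestrictsTo.refl _).kronecker (tensorRestrictsTo_kronecker_matMulTensor_one K S))

/-- **One level of the recursion** (the constituent stage at level `ℓ`, Thms. 6.2 and 6.4, plugged
into what the previous stages produced).  If `t` copies of the input `P` restrict to `V` independent
copies of `S ⊗ ⟨A, B, C⟩` (`S` a level-`ℓ` interface tensor, `⟨A,B,C⟩` the matrix multiplication
tensor accumulated from the levels above), and `M` copies of `S` restrict to `V'` independent copies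
of `S' ⊗ ⟨A', B', C'⟩` (`S'` the level-`(ℓ−1)` interface tensor, `⟨A',B',C'⟩` the product of the
matrix multiplication terms of level `ℓ`), then `M t` copies of `P` restrict to `V V'` independent
copies of `S' ⊗ ⟨A A', B B', C C'⟩`: copies of the input multiply (`2^{o(n)} · 2^{o(n)}`), output
counts multiply (`V_{ℓ−1} = V_ℓ · 2^{ΣE_r − o(n)}`), and the matrix multiplication tensors multiply
(`⟨A,B,C⟩ ⊗ ⟨A',B',C'⟩ ≅ ⟨AA',BB',CC'⟩`). [cite: AlmanDuanVassilevskaWilliamsXuXuZhou2025, §4 ("for ℓ = ℓ*, …, 2 we apply the constituent stage …") and §7 (Algorithm 1)] -/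
theorem laserRecursion_step (P : ιP → κP → μP → K) (S : ιS → κS → μS → K)
    (S' : ιS' → κS' → μS' → K) {t V A B C M V' A' B' C' : ℕ}
    (h₁ : TensorRestrictsTo (kroneckerTensor (unitTensor K t) P)
      (kroneckerTensor (unitTensor K V) (kroneckerTensor S (matMulTensor K A B C))))
    (h₂ : TensorRestrictsTo (kroneckerTensor (unitTensor K M) S)
      (kroneckerTensor (unitTensor K V') (kroneckerTensor S' (matMulTensor K A' B' C')))) :
    TensorRestrictsTo (kroneckerTensor (unitTensor K (M * t)) P)
      (kroneckerTensor (unitTensor K (V * V'))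
        (kroneckerTensor S' (matMulTensor K (A * A') (B * B') (C * C')))) := by
  -- `⟨M t⟩ ⊗ P ≥ (⟨M⟩ ⊗ ⟨t⟩) ⊗ P ≥ ⟨M⟩ ⊗ (⟨t⟩ ⊗ P) ≥ ⟨M⟩ ⊗ (⟨V⟩ ⊗ (S ⊗ mm))`
  refine ((tensorRestrictsTo_mul_unitTensor K M t).kronecker (TensorRestrictsTo.refl P)).trans ?_
  refine (tensorRestrictsTo_kronecker_assoc' K (unitTensor K M) (unitTensor K t) P).trans ?_
  refine ((TensorRestrictsTo.refl (unitTensor K M)).kronecker h₁).trans ?_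
  -- `… ≥ (⟨M⟩ ⊗ ⟨V⟩) ⊗ (S ⊗ mm) ≥ (⟨V⟩ ⊗ ⟨M⟩) ⊗ (S ⊗ mm) ≥ ⟨V⟩ ⊗ (⟨M⟩ ⊗ (S ⊗ mm))`
  refine (tensorRestrictsTo_kronecker_assoc K (unitTensor K M) (unitTensor K V)
    (kroneckerTensor S (matMulTensor K A B C))).trans ?_
  refine ((tensorRestrictsTo_kronecker_comm K (unitTensor K M) (unitTensor K V)).kronecker
    (TensorRestrictsTo.refl (kroneckerTensor S (matMulTensor K A B C)))).trans ?_
  refine (tensorRestrictsTo_kronecker_assoc' K (unitTensor K V) (unitTensor K M)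
    (kroneckerTensor S (matMulTensor K A B C))).trans ?_
  -- `… ≥ ⟨V⟩ ⊗ ((⟨M⟩ ⊗ S) ⊗ mm) ≥ ⟨V⟩ ⊗ ((⟨V'⟩ ⊗ (S' ⊗ mm')) ⊗ mm)`
  refine ((TensorRestrictsTo.refl (unitTensor K V)).kronecker
    (tensorRestrictsTo_kronecker_assoc K (unitTensor K M) S (matMulTensor K A B C))).trans ?_
  refine ((TensorRestrictsTo.refl (unitTensor K V)).kronecker
    (h₂.kronecker (TensorRestrictsTo.refl (matMulTensor K A B C)))).trans ?_
  -- `… ≥ ⟨V⟩ ⊗ (⟨V'⟩ ⊗ ((S' ⊗ mm') ⊗ mm)) ≥ (⟨V⟩ ⊗ ⟨V'⟩) ⊗ ((S' ⊗ mm') ⊗ mm)`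
  refine ((TensorRestrictsTo.refl (unitTensor K V)).kronecker
    (tensorRestrictsTo_kronecker_assoc' K (unitTensor K V')
      (kroneckerTensor S' (matMulTensor K A' B' C')) (matMulTensor K A B C))).trans ?_
  refine (tensorRestrictsTo_kronecker_assoc K (unitTensor K V) (unitTensor K V')
    (kroneckerTensor (kroneckerTensor S' (matMulTensor K A' B' C')) (matMulTensor K A B C))).trans ?_
  -- `… ≥ ⟨V V'⟩ ⊗ (S' ⊗ (mm' ⊗ mm)) ≥ ⟨V V'⟩ ⊗ (S' ⊗ (mm ⊗ mm')) ≥ ⟨V V'⟩ ⊗ (S' ⊗ ⟨AA',BB',CC'⟩)`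
  refine ((tensorRestrictsTo_unitTensor_mul K V V').kronecker
    (tensorRestrictsTo_kronecker_assoc' K S' (matMulTensor K A' B' C') (matMulTensor K A B C))).trans ?_
  refine ((TensorRestrictsTo.refl (unitTensor K (V * V'))).kronecker
    ((TensorRestrictsTo.refl S').kronecker
      (tensorRestrictsTo_kronecker_comm K (matMulTensor K A' B' C') (matMulTensor K A B C)))).trans ?_
  exact (TensorRestrictsTo.refl (unitTensor K (V * V'))).kronecker
    ((TensorRestrictsTo.refl S').kronecker (tensorRestrictsTo_kronecker_matMulTensor K A B C A' B' C'))

omit [DecidableEq ιP] [DecidableEq κP] [DecidableEq μP] [DecidableEq ιS] [DecidableEq κS]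
  [DecidableEq μS] in
/-- **End of the recursion** (level 1): if `t` copies of `P` restrict to `V` independent copies of
`S ⊗ ⟨A, B, C⟩` and the level-1 interface tensor `S` restricts to the matrix multiplication tensor
`⟨A', B', C'⟩` (`LevelOneInterface.vxxz2024_levelOne_degeneration`), then `t` copies of `P` restrict
to `V` independent copies of `⟨A A', B B', C C'⟩` — the output "a direct sum of matrix multiplication
tensors" of Algorithm 1. [cite: AlmanDuanVassilevskaWilliamsXuXuZhou2025, §4 ("eventually … independent copies of level-1 interface tensors and a matrix multiplication tensor, which can then be degenerated into independent copies of matrix multiplication tensors") and §7 (Algorithm 1)] -/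
theorem laserRecursion_finish (P : ιP → κP → μP → K) (S : ιS → κS → μS → K)
    {t V A B C A' B' C' : ℕ}
    (h₁ : TensorRestrictsTo (kroneckerTensor (unitTensor K t) P)
      (kroneckerTensor (unitTensor K V) (kroneckerTensor S (matMulTensor K A B C))))
    (h₂ : TensorRestrictsTo S (matMulTensor K A' B' C')) :
    TensorRestrictsTo (kroneckerTensor (unitTensor K t) P)
      (kroneckerTensor (unitTensor K V) (matMulTensor K (A * A') (B * B') (C * C'))) := by
  refine h₁.trans ((TensorRestrictsTo.refl (unitTensor K V)).kronecker ?_)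
  refine (h₂.kronecker (TensorRestrictsTo.refl (matMulTensor K A B C))).trans ?_
  exact (tensorRestrictsTo_kronecker_comm K (matMulTensor K A' B' C') (matMulTensor K A B C)).trans
    (tensorRestrictsTo_kronecker_matMulTensor K A B C A' B' C')

/-- **End of the recursion, with input copies at level 1** (the same when the level-1 step is stated,
like the other stages, for `M` copies of `S` and `V'` output copies:
`⟨M⟩ ⊗ S ≥ ⟨V'⟩ ⊗ ⟨A', B', C'⟩`). [cite: AlmanDuanVassilevskaWilliamsXuXuZhou2025, §4 and §7 (Algorithm 1)] -/
theorem laserRecursion_finish' (P : ιP → κP → μP → K) (S : ιS → κS → μS → K)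
    {t V A B C M V' A' B' C' : ℕ}
    (h₁ : TensorRestrictsTo (kroneckerTensor (unitTensor K t) P)
      (kroneckerTensor (unitTensor K V) (kroneckerTensor S (matMulTensor K A B C))))
    (h₂ : TensorRestrictsTo (kroneckerTensor (unitTensor K M) S)
      (kroneckerTensor (unitTensor K V') (matMulTensor K A' B' C'))) :
    TensorRestrictsTo (kroneckerTensor (unitTensor K (M * t)) P)
      (kroneckerTensor (unitTensor K (V * V')) (matMulTensor K (A * A') (B * B') (C * C'))) := by
  -- view `⟨V'⟩ ⊗ mm'` as `⟨V'⟩ ⊗ (mm' ⊗ ⟨1,1,1⟩)`, run one step, and finish with `⟨1,1,1⟩ ⊗ … `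
  have h₂' : TensorRestrictsTo (kroneckerTensor (unitTensor K M) S)
      (kroneckerTensor (unitTensor K V')
        (kroneckerTensor (matMulTensor K A' B' C') (matMulTensor K 1 1 1))) :=
    h₂.trans ((TensorRestrictsTo.refl _).kronecker
      (tensorRestrictsTo_kronecker_matMulTensor_one K (matMulTensor K A' B' C')))
  have h := laserRecursion_step K P S (matMulTensor K A' B' C') h₁ h₂'
  have h' := laserRecursion_finish K P (matMulTensor K A' B' C') h (TensorRestrictsTo.refl _)
  refine h'.trans (tensorRestrictsTo_multiple_matMulTensor_of_eq K rfl ?_ ?_ ?_) <;> ring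

end Chaining

/-! ## From logarithmic bounds to rates -/

section Rates

/-- `log₂ t ≤ x` gives `t ≤ 2^x` (`t ≥ 1`; the input copies `2^{o(n)}` of the stages, e.g.
`GlobalStageAsymptotic.vxxz2024_thm53_asymptotic`: `log₂ (inputCopies c n) ≤ δ n`). [folklore] -/
theorem le_two_rpow_of_logb_le {t : ℕ} (ht : 1 ≤ t) {x : ℝ} (h : Real.logb 2 t ≤ x) :
    (t : ℝ) ≤ (2 : ℝ) ^ x := by
  have ht0 : (0 : ℝ) < t := by exact_mod_cast ht
  exact (Real.logb_le_iff_le_rpow (by norm_num) ht0).1 h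

/-- `x ≤ log₂ (V + 1)` with `x ≥ 1` gives `2^{x−1} ≤ V` (the output counts of the stages, e.g.
`vxxz2024_thm53_asymptotic`: `n (E − δ) ≤ log₂ (κ + 1)`; the `−1` is absorbed by the rates for large
`n`). [folklore] -/
theorem two_rpow_sub_one_le_of_le_logb_succ {V : ℕ} {x : ℝ} (hx : 1 ≤ x)
    (h : x ≤ Real.logb 2 ((V : ℝ) + 1)) : (2 : ℝ) ^ (x - 1) ≤ V := by
  have hV1 : (0 : ℝ) < (V : ℝ) + 1 := by positivity
  have h2x : (2 : ℝ) ^ x ≤ (V : ℝ) + 1 := (Real.le_logb_iff_rpow_le (by norm_num) hV1).1 h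
  have h2 : (2 : ℝ) ≤ (2 : ℝ) ^ x := by
    calc (2 : ℝ) = (2 : ℝ) ^ (1 : ℝ) := (Real.rpow_one 2).symm
      _ ≤ (2 : ℝ) ^ x := Real.rpow_le_rpow_of_exponent_le (by norm_num) hx
  rw [Real.rpow_sub (by norm_num), Real.rpow_one]
  rw [div_le_iff₀ (by norm_num : (0 : ℝ) < 2)]
  have hV0 : (0 : ℝ) ≤ V := Nat.cast_nonneg _
  nlinarith

/-- Rates multiply: `2^a ≤ X`, `2^b ≤ Y` give `2^{a+b} ≤ X Y` (the counts and formats produced by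
`laserRecursion_step` are products over the levels). [folklore] -/
theorem two_rpow_add_mul_le_mul {a b X Y : ℝ} (hX : (2 : ℝ) ^ a ≤ X) (hY : (2 : ℝ) ^ b ≤ Y) :
    (2 : ℝ) ^ (a + b) ≤ X * Y := by
  rw [Real.rpow_add (by norm_num)]
  exact mul_le_mul hX hY (by positivity) ((by positivity : (0 : ℝ) ≤ (2 : ℝ) ^ a).trans hX)

end Rates

/-! ## The limiting condition gives the certificate -/

section Certificate

/-- **The limiting condition of the asymmetric laser method gives a `CW_5` degeneration
certificate.**  Let `L ≥ 1` (`= 2^{ℓ*−1}`), `κ ≥ 0`, `ω' ≥ 0`, `m > 0` and `v` be reals with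
`L · log₂ 7 ≤ v + ω' · m` — the limiting condition
`lim_{ε→0} lim_{n→∞} V^{1/n} · min{A, B^{1/κ}, C}^{ω'/n} ≥ (q+2)^{2^{ℓ*−1}}` of §7 at `q = 5`, in
logarithmic form with `v = lim log₂ V^{1/n}` and `m ≤ min{a, b/κ, c}` for the rates `a, b, c` of
`A, B, C`.  Suppose that for every `η > 0` and every `n₀` the method outputs, for some `n ≥ n₀`, a
degeneration of `t ≤ 2^{ηn}` independent copies of `(CW_5^{⊗L})^{⊗n}` into `V ≥ 2^{(v−η)n}`
independent copies of `⟨A, B, C⟩` with `A, C ≥ 2^{(m−η)n}` and `B ≥ 2^{(κm−η)n}` (the output of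
Algorithm 1, Thms. 5.3/6.2/6.4, for `ε` small and `n` large).  Then
`CW5DegenerationCertificate [(κ, ω')]`, hence `ω(1, κ, 1) ≤ ω'`
(`omegaRect_le_of_cw5DegenerationCertificate`).  Proof: given `δ > 0` take
`η = mδ / (4 + 2C(ω'+δ))`, `C = max{2, 1/κ + 1}`, `n` large, and restrict `⟨A, B, C⟩` to
`⟨a, B, a⟩` with `a = ⌊2^{(m − Cη)n}⌋`: then `2 ≤ a ≤ A, C`, `a^κ ≤ B`, and
`t · 7^{Ln} ≤ 2^{ηn + L n log₂ 7} ≤ 2^{(v−η)n + ((m−Cη)n − 1)(ω'+δ)} ≤ V · a^{ω'+δ}`.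
[cite: AlmanDuanVassilevskaWilliamsXuXuZhou2025, §7 (Algorithm 1 and the limiting condition of the optimisation problem)] -/
theorem cw5Certificate_of_rates {L : ℕ} (hL : 1 ≤ L) {κ w v m : ℝ} (hκ : 0 ≤ κ) (hw : 0 ≤ w)
    (hm : 0 < m) (hlim : (L : ℝ) * Real.logb 2 7 ≤ v + w * m)
    (h : ∀ η : ℝ, 0 < η → ∀ n₀ : ℕ, ∃ n : ℕ, n₀ ≤ n ∧ ∃ t V A B C : ℕ, 1 ≤ t ∧
      PolyDegeneratesTo
        (kroneckerTensor (unitTensor ℂ t) (kroneckerPow (kroneckerPow (bigCwTensor ℂ 5) L) n))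
        (kroneckerTensor (unitTensor ℂ V) (matMulTensor ℂ A B C)) ∧
      (t : ℝ) ≤ (2 : ℝ) ^ (η * n) ∧ (2 : ℝ) ^ ((v - η) * n) ≤ V ∧
      (2 : ℝ) ^ ((m - η) * n) ≤ A ∧ (2 : ℝ) ^ ((κ * m - η) * n) ≤ B ∧
      (2 : ℝ) ^ ((m - η) * n) ≤ C) :
    CW5DegenerationCertificate [(κ, w)] := by
  intro k b hkb δ hδ
  have hrow : k = κ ∧ b = w := by simpa using hkb
  obtain ⟨hk, hb⟩ := hrow
  rw [hk, hb]
  -- the constant `C = max {2, 1/κ + 1}` and the loss `η`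
  have hm0 : m ≠ 0 := hm.ne'
  obtain ⟨Cκ, hCκ⟩ : ∃ C : ℝ, C = max 2 (κ⁻¹ + 1) := ⟨_, rfl⟩
  have hC2 : (2 : ℝ) ≤ Cκ := hCκ ▸ le_max_left _ _
  have hC1 : (1 : ℝ) ≤ Cκ := le_trans (by norm_num) hC2
  have hC0 : (0 : ℝ) < Cκ := by linarith
  have hκC : κ = 0 ∨ 1 ≤ κ * Cκ := by
    rcases hκ.eq_or_lt with h0 | hpos
    · exact Or.inl h0.symm
    · refine Or.inr ?_
      have hne : κ ≠ 0 := hpos.ne'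
      have h1 : κ⁻¹ + 1 ≤ Cκ := hCκ ▸ le_max_right _ _
      have h2 : κ * (κ⁻¹ + 1) = 1 + κ := by rw [mul_add, mul_inv_cancel₀ hne, mul_one]
      have h3 : κ * (κ⁻¹ + 1) ≤ κ * Cκ := mul_le_mul_of_nonneg_left h1 hpos.le
      linarith
  have hwδ : 0 < w + δ := by linarith
  have hden : 0 < 4 + 2 * Cκ * (w + δ) := by positivity
  have hD : 4 + 2 * Cκ * (w + δ) ≠ 0 := hden.ne'
  obtain ⟨η, hη⟩ : ∃ η : ℝ, η = m * δ / (4 + 2 * Cκ * (w + δ)) := ⟨_, rfl⟩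
  have hη0 : 0 < η := by rw [hη]; positivity
  have hηkey : (2 * η + Cκ * η * (w + δ)) * 2 = m * δ := by
    rw [hη]
    field_simp
    ring
  have hηm : Cκ * η * 2 ≤ m := by
    have hCηw : 0 ≤ Cκ * η * w := by positivity
    have h1 : Cκ * η * 2 * δ ≤ m * δ := by linarith
    exact le_of_mul_le_mul_right h1 hδ
  have hηC : η ≤ Cκ * η := le_mul_of_one_le_left hη0.le hC1
  -- a large `n` and the output of the method there
  obtain ⟨n₁, hn₁⟩ := exists_nat_ge (max (2 / m) (2 * (w + δ) / (m * δ)))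
  obtain ⟨n, hn, t, V, A, B, C, ht, hdeg, htb, hVb, hAb, hBb, hCb⟩ := h η hη0 (max n₁ 1)
  have hn1 : 1 ≤ n := le_trans (le_max_right _ _) hn
  have hnR : (0 : ℝ) < n := by exact_mod_cast hn1
  have hn_ge : (n₁ : ℝ) ≤ n := by exact_mod_cast le_trans (le_max_left _ _) hn
  have hn2m : 2 / m ≤ n := le_trans (le_trans (le_max_left _ _) hn₁) hn_ge
  have hnwd : 2 * (w + δ) / (m * δ) ≤ n := le_trans (le_trans (le_max_right _ _) hn₁) hn_ge
  -- the side `a = ⌊x⌋`, `x = 2^{(m − Cη) n}`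
  obtain ⟨x, hx⟩ : ∃ x : ℝ, x = (2 : ℝ) ^ ((m - Cκ * η) * n) := ⟨_, rfl⟩
  have hx0 : 0 ≤ x := by rw [hx]; positivity
  have hexp1 : (1 : ℝ) ≤ (m - Cκ * η) * n := by
    have h1 : m / 2 ≤ m - Cκ * η := by linarith
    have h2 : m / 2 * (2 / m) ≤ (m - Cκ * η) * n :=
      mul_le_mul h1 hn2m (by positivity) (by linarith)
    have h3 : m / 2 * (2 / m) = 1 := by field_simp
    linarith
  have hx2 : (2 : ℝ) ≤ x := by
    rw [hx]
    calc (2 : ℝ) = (2 : ℝ) ^ (1 : ℝ) := (Real.rpow_one 2).symm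
      _ ≤ (2 : ℝ) ^ ((m - Cκ * η) * n) := Real.rpow_le_rpow_of_exponent_le (by norm_num) hexp1
  obtain ⟨a, ha⟩ : ∃ a : ℕ, a = ⌊x⌋₊ := ⟨_, rfl⟩
  have ha2 : 2 ≤ a := by
    rw [ha, Nat.le_floor_iff hx0]
    exact_mod_cast hx2
  have hax : (a : ℝ) ≤ x := by rw [ha]; exact Nat.floor_le hx0
  have hxa : x / 2 ≤ a := by
    have h1 : x < (a : ℝ) + 1 := by rw [ha]; exact Nat.lt_floor_add_one x
    linarith
  -- `a ≤ A`, `a ≤ C`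
  have hexpA : (m - Cκ * η) * n ≤ (m - η) * n :=
    mul_le_mul_of_nonneg_right (by linarith) hnR.le
  have hxA : x ≤ A := hx ▸ le_trans (Real.rpow_le_rpow_of_exponent_le (by norm_num) hexpA) hAb
  have hxC : x ≤ C := hx ▸ le_trans (Real.rpow_le_rpow_of_exponent_le (by norm_num) hexpA) hCb
  have haA : a ≤ A := by exact_mod_cast hax.trans hxA
  have haC : a ≤ C := by exact_mod_cast hax.trans hxC
  -- `a^κ ≤ B`
  have hB1 : (1 : ℝ) ≤ B := by
    have hBpos : (0 : ℝ) < B := lt_of_lt_of_le (by positivity) hBb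
    have hB : 1 ≤ B := by exact_mod_cast hBpos
    exact_mod_cast hB
  have haκB : (a : ℝ) ^ κ ≤ B := by
    rcases hκC with h0 | h1
    · rw [h0, Real.rpow_zero]
      exact hB1
    · have hexpB : (m - Cκ * η) * n * κ ≤ (κ * m - η) * n := by
        have h2 : 1 * (η * n) ≤ κ * Cκ * (η * n) :=
          mul_le_mul_of_nonneg_right h1 (by positivity)
        nlinarith
      calc (a : ℝ) ^ κ ≤ x ^ κ := Real.rpow_le_rpow (Nat.cast_nonneg _) hax hκ
        _ = (2 : ℝ) ^ ((m - Cκ * η) * n * κ) := by rw [hx, ← Real.rpow_mul (by norm_num)]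
        _ ≤ (2 : ℝ) ^ ((κ * m - η) * n) := Real.rpow_le_rpow_of_exponent_le (by norm_num) hexpB
        _ ≤ B := hBb
  -- the count `t · 7^{L n} ≤ V · a^{w + δ}`
  have h7 : (7 : ℝ) ^ (L * n) = (2 : ℝ) ^ (Real.logb 2 7 * ((L * n : ℕ) : ℝ)) := by
    rw [Real.rpow_mul (by norm_num), Real.rpow_logb (by norm_num) (by norm_num) (by norm_num),
      Real.rpow_natCast]
  have ha_low : (2 : ℝ) ^ ((m - Cκ * η) * n - 1) ≤ a := by
    have h1 : (2 : ℝ) ^ ((m - Cκ * η) * n - 1) = x / 2 := by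
      rw [hx, Real.rpow_sub (by norm_num), Real.rpow_one]
    rw [h1]
    exact hxa
  have hapow : (2 : ℝ) ^ (((m - Cκ * η) * n - 1) * (w + δ)) ≤ (a : ℝ) ^ (w + δ) := by
    rw [Real.rpow_mul (by norm_num)]
    exact Real.rpow_le_rpow (by positivity) ha_low hwδ.le
  have hkey : η * n + Real.logb 2 7 * ((L * n : ℕ) : ℝ) ≤
      (v - η) * n + ((m - Cκ * η) * n - 1) * (w + δ) := by
    push_cast
    have hL7 : Real.logb 2 7 * ((L : ℝ) * n) ≤ (v + w * m) * n := by
      have h1 := mul_le_mul_of_nonneg_right hlim hnR.le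
      linarith
    have hnd : w + δ ≤ n * (m * δ / 2) := by
      have h1 := hnwd
      rw [div_le_iff₀ (by positivity)] at h1
      linarith
    have e1 : (2 * η + Cκ * η * (w + δ)) * 2 * n = m * δ * n := by rw [hηkey]
    linarith
  have hcount : (t : ℝ) * 7 ^ (L * n) ≤ (V : ℝ) * (a : ℝ) ^ (w + δ) := by
    calc (t : ℝ) * 7 ^ (L * n) = (t : ℝ) * (2 : ℝ) ^ (Real.logb 2 7 * ((L * n : ℕ) : ℝ)) := by
          rw [h7]
      _ ≤ (2 : ℝ) ^ (η * n) * (2 : ℝ) ^ (Real.logb 2 7 * ((L * n : ℕ) : ℝ)) :=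
          mul_le_mul_of_nonneg_right htb (by positivity)
      _ = (2 : ℝ) ^ (η * n + Real.logb 2 7 * ((L * n : ℕ) : ℝ)) := by
          rw [Real.rpow_add (by norm_num)]
      _ ≤ (2 : ℝ) ^ ((v - η) * n + ((m - Cκ * η) * n - 1) * (w + δ)) :=
          Real.rpow_le_rpow_of_exponent_le (by norm_num) hkey
      _ = (2 : ℝ) ^ ((v - η) * n) * (2 : ℝ) ^ (((m - Cκ * η) * n - 1) * (w + δ)) := by
          rw [Real.rpow_add (by norm_num)]
      _ ≤ (V : ℝ) * (a : ℝ) ^ (w + δ) :=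
          mul_le_mul hVb hapow (by positivity) (Nat.cast_nonneg _)
  -- the degeneration `⟨t⟩ ⊗ CW_5^{⊗(L n)} ⊵ ⟨V⟩ ⊗ ⟨a, B, a⟩`
  have hdeg' : PolyDegeneratesTo
      (kroneckerTensor (unitTensor ℂ t) (kroneckerPow (bigCwTensor ℂ 5) (L * n)))
      (kroneckerTensor (unitTensor ℂ V) (matMulTensor ℂ a B a)) := by
    have h1 := tensorRestrictsTo_multiple_kroneckerPow_mul ℂ (bigCwTensor ℂ 5) t L n
    have h2 : TensorRestrictsTo (kroneckerTensor (unitTensor ℂ V) (matMulTensor ℂ A B C))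
        (kroneckerTensor (unitTensor ℂ V) (matMulTensor ℂ a B a)) :=
      (TensorRestrictsTo.refl _).kronecker (tensorRestrictsTo_matMulTensor_of_le ℂ haA le_rfl haC)
    exact (h1.trans_polyDegeneratesTo hdeg).trans_restrictsTo h2
  have hN : 1 ≤ L * n := by
    have h1 := Nat.mul_le_mul hL hn1
    simpa using h1
  have hV1 : 1 ≤ V := by
    have hVpos : (0 : ℝ) < V := lt_of_lt_of_le (by positivity) hVb
    exact_mod_cast hVpos
  exact ⟨L * n, t, V, a, B, hN, ht, hV1, ha2, haκB, hdeg', hcount⟩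

/-- **The record from the rate-form output of Algorithm 1 at `κ = 1`.**  If for every `η > 0` and
arbitrarily large `n` the method (Thms. 5.3, 6.2, 6.4 at the `κ = 1` parameter file of §7) degenerates
`t ≤ 2^{ηn}` independent copies of `(CW_5^{⊗4})^{⊗n}` into `V ≥ 2^{(v−η)n}` independent copies of
`⟨A, B, C⟩` with `A, B, C ≥ 2^{(m−η)n}`, `m > 0`, and the limiting condition
`4 log₂ 7 ≤ v + 2.371339 · m` holds, then `ω ≤ 2.371339` (`advxxz2025_omega_le`): the certificate
`CW5DegenerationCertificate [(1, 2.371339)]` of `cw5Certificate_of_rates`, then layers 1–2 of the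
printed proof (`omegaRect_le_of_cw5DegenerationCertificate` and `ω(1,1,1) = ω`, the one-liner of
`RectangularExponentSquareRecord.advxxz2025_omega_le_of_cw5Certificate_row`). [cite: AlmanDuanVassilevskaWilliamsXuXuZhou2025, §7 ("All these bounds were derived by analyzing CW_5^{⊗4}"; "we showed that ω ≤ 2.371339")] -/
theorem advxxz2025_omega_le_of_rates {v m : ℝ} (hm : 0 < m)
    (hlim : 4 * Real.logb 2 7 ≤ v + 2.371339 * m)
    (h : ∀ η : ℝ, 0 < η → ∀ n₀ : ℕ, ∃ n : ℕ, n₀ ≤ n ∧ ∃ t V A B C : ℕ, 1 ≤ t ∧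
      PolyDegeneratesTo
        (kroneckerTensor (unitTensor ℂ t) (kroneckerPow (kroneckerPow (bigCwTensor ℂ 5) 4) n))
        (kroneckerTensor (unitTensor ℂ V) (matMulTensor ℂ A B C)) ∧
      (t : ℝ) ≤ (2 : ℝ) ^ (η * n) ∧ (2 : ℝ) ^ ((v - η) * n) ≤ V ∧
      (2 : ℝ) ^ ((m - η) * n) ≤ A ∧ (2 : ℝ) ^ ((m - η) * n) ≤ B ∧
      (2 : ℝ) ^ ((m - η) * n) ≤ C) :
    advxxz2025_omega_le := by
  have hc : CW5DegenerationCertificate [((1 : ℝ), (2.371339 : ℝ))] := by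
    refine cw5Certificate_of_rates (L := 4) (κ := 1) (w := 2.371339) (v := v) (m := m) (by norm_num)
      zero_le_one (by norm_num) hm (by exact_mod_cast hlim) fun η hη n₀ => ?_
    obtain ⟨n, hn, t, V, A, B, C, ht, hdeg, htb, hVb, hAb, hBb, hCb⟩ := h η hη n₀
    exact ⟨n, hn, t, V, A, B, C, ht, hdeg, htb, hVb, hAb, by rwa [one_mul], hCb⟩
  have h1 : omegaRect ℂ 1 1 1 ≤ 2.371339 :=
    omegaRect_le_of_cw5DegenerationCertificate hc (by simp) zero_le_one
  unfold advxxz2025_omega_le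
  rwa [omegaRect_one_one_one] at h1

end Certificate

end Literature.Computability.AlgebraicComplexity

end
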